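import Summits.BirchSwinnertonDyer.BirchSwinnertonDyer.Theorems.PublishedInputsGreenbergLemma34CocycleLemmas
import HarnessLib

set_option linter.dupNamespace false -- `…BirchSwinnertonDyer.BirchSwinnertonDyer…` is the cell's nested layout (D-0017)
set_option autoImplicit false

/-!
# Greenberg LNM 1716 Lemma 3.4 at the layers `n ≥ 1`, brick 3: inflation cocycles on `Gal(K̄/K_n)` with a prescribed
# value at `γ_n = γ₀^{pⁿ}` (the layer-`n` form of gen 5's `ZpExtension.exists_cocycle_vanishing_apply_eq_of_nsmul_eq_sub`)

Seat `bsd-inputs-k4-p1` (gen 6; LADDER-BSD D-0154 KEY (147)(f) «prove the printed input», row 1 K4 INPUTS; Greenberg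
1999), `--supports stmt-BirchSwinnertonDyer-20309`. THEOREMS ONLY (no definition, no named fact, no `sorry`).

Greenberg, LNM 1716, §3 (pp. 86–89) computes `ker(r_{v_n}) ≅ H¹(Γ_{v_n}, ·)` for the pro-cyclic
`Γ_{v_n} = Gal((F_∞)_η/(F_n)_{v_n})`, topologically generated by `γ_{v_n}`; at the layer `n` of a `ℤ_p`-extension `κ` with
topological generator `γ₀` this is the quotient of `H_n = Gal(K̄/K_n) = κ⁻¹(pⁿℤ_p)` (`κ.layerSubgroup n`) by `N = ker κ`,
generated by `γ_n = γ₀^{pⁿ}`. Gen 5 of this seat built the cocycle toolkit for the layer `0` (`H_0 = Γ_K`, generator `γ₀`);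
this file is its layer-`n` form, for continuous cocycles of the open subgroup `H_n` (Mathlib's continuous cohomology of
`discreteTopRep (κ.layerSubgroup n) M`):

* `layerSubgroup_subgroup_eq_top` — an open subgroup of `H_n` containing `N` and `γ_n` is all of `H_n`
  (`ZpExtension.layerSubgroup_le_of_isOpen`, transported to the subgroup type).
* `contOneCocycles_layer_eq_zero_of_apply_eq_zero` — a continuous cocycle of `H_n` vanishing on `N` and at `γ_n`
  vanishes identically; `contOneCocycles_layer_apply_mem_of_apply_mem` — with value at `γ_n` in a `Γ`-stable subgroup
  `A₁`, all its values lie in `A₁`.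
* `exists_layerCocycle_vanishing_apply_eq_of_sSeq_eq_zero` — for `b ∈ M^N` with norm sum
  `s_{p^m}^{(γ_n)}(b) = b + γ_n b + ⋯ + γ_n^{p^m − 1} b = 0`: a continuous cocycle `ψ` of `H_n` vanishing on `N` with
  `ψ(γ_n) = b` — `ψ(g) = s_a^{(γ_n)}(b)` for `κ g ≡ a pⁿ (mod p^{n+m})`, from the decomposition `g = γ_n^a τ v`
  (`ZpExtension.exists_eq_pow_mul_mul`).
* `exists_layerCocycle_vanishing_apply_eq_of_nsmul_eq_sub` — the same for every `b` with `p^k b = γ_n y − y`,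
  `b, y ∈ M^N` (some `γ_n^{p^A}` fixes `b` and `y`, and then `s_{p^{A+k}}(b) = p^k s_{p^A}(b) = γ_n^{p^A} y − y = 0`).

HONEST FRAMING: group-cohomology bookkeeping (TOOL theorems); closes nothing; no summit statement is proved; BSD is not
proved by any of this.

References: [GreenbergLNM1716] §3 Lemmas 3.1–3.4 (pp. 86–89); [SerreGaloisCohomology1997] I §2.2, XIII §1;
[Washington1997] §13.1.
-/

noncomputable section

open scoped Classical

universe u

namespace Summit.BirchSwinnertonDyer.BirchSwinnertonDyer.Theorems.InputsGreenbergLemma34Layer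

open Field Literature.NumberTheory.EllipticCurves Literature.NumberTheory.GaloisRepresentations
  Literature.NumberTheory.EllipticCurves.ZpExtension Literature.NumberTheory.EllipticCurves.LayerCocycle
  _root_.ContinuousCohomology Summit.BirchSwinnertonDyer.BirchSwinnertonDyer.Theorems.InputsGreenbergLemma34

variable {K : Type u} [Field K] [CharZero K] {p : ℕ} [hp : Fact p.Prime] (κ : ZpExtension K p)
  {M : Type u} [AddCommGroup M] [DistribMulAction (absoluteGaloisGroup K) M]
  [TopologicalSpace M] [DiscreteTopology M]

/-! ## §1 Topological generation of `H_n` by `N` and `γ_n`, on the subgroup type -/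

/-- **An open subgroup of `H_n = κ⁻¹(pⁿℤ_p)` containing `N = ker κ` and `γ_n = γ₀^{pⁿ}` is everything** (`κ γ₀ = 1`):
`ZpExtension.layerSubgroup_le_of_isOpen` transported to the subgroup type `↥(κ.layerSubgroup n)` (the image of an open
subgroup of the open subgroup `H_n` is open in `Γ_K`). [cite: Washington1997, §13.1] -/
theorem layerSubgroup_subgroup_eq_top {γ₀ : absoluteGaloisGroup K} (hγ₀ : κ.IsTopGenerator γ₀) (n : ℕ)
    (U : Subgroup (κ.layerSubgroup n)) (hU : IsOpen (U : Set (κ.layerSubgroup n)))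
    (hNU : ∀ τ : κ.layerSubgroup n, (τ : absoluteGaloisGroup K) ∈ κ.kerSubgroup → τ ∈ U)
    (hγU : (⟨γ₀ ^ p ^ n, pow_mem_layerSubgroup κ hγ₀ n⟩ : κ.layerSubgroup n) ∈ U) : U = ⊤ := by
  let U' : Subgroup (absoluteGaloisGroup K) := U.map (κ.layerSubgroup n).subtype
  have hopen : IsOpen (U' : Set (absoluteGaloisGroup K)) := (κ.isOpen_layerSubgroup n).isOpenMap_subtype_val _ hU
  have hN' : κ.kerSubgroup ≤ U' := fun τ hτ ↦
    ⟨⟨τ, κ.kerSubgroup_le_layerSubgroup n hτ⟩, hNU _ hτ, rfl⟩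
  have hγU' : γ₀ ^ p ^ n ∈ U' := ⟨_, hγU, rfl⟩
  have hle := κ.layerSubgroup_le_of_isOpen hγ₀ n U' hopen hN' hγU'
  rw [eq_top_iff]
  intro x _
  obtain ⟨u, hu, hux⟩ := hle x.2
  have : u = x := Subtype.ext hux
  exact this ▸ hu

/-- **A continuous cocycle of `H_n` vanishing on `N` and at `γ_n` vanishes identically** (its zero locus is an open
subgroup containing both). Layer-`n` form of gen 5's `contOneCocycles_eq_zero_of_apply_eq_zero`.
[cite: SerreGaloisCohomology1997, I §2.2] -/
theorem contOneCocycles_layer_eq_zero_of_apply_eq_zero {γ₀ : absoluteGaloisGroup K} (hγ₀ : κ.IsTopGenerator γ₀) (n : ℕ)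
    (ψ : contOneCocycles (discreteTopRep (κ.layerSubgroup n) M))
    (hN : ∀ τ : κ.layerSubgroup n, (τ : absoluteGaloisGroup K) ∈ κ.kerSubgroup → ψ.1 τ = 0)
    (hg : ψ.1 ⟨γ₀ ^ p ^ n, pow_mem_layerSubgroup κ hγ₀ n⟩ = 0) (σ : κ.layerSubgroup n) : ψ.1 σ = 0 := by
  have htop := layerSubgroup_subgroup_eq_top κ hγ₀ n (oneCocycleKer ψ) (isOpen_oneCocycleKer ψ)
    (fun τ hτ ↦ (mem_oneCocycleKer_iff ψ τ).mpr (hN τ hτ)) ((mem_oneCocycleKer_iff ψ _).mpr hg)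
  exact (mem_oneCocycleKer_iff ψ σ).mp (htop ▸ Subgroup.mem_top σ)

/-- **A continuous cocycle of `H_n` vanishing on `N` whose value at `γ_n` lies in a `Γ`-stable subgroup `A₁` takes all
its values in `A₁`** (`{σ : ψ σ ∈ A₁}` is an open subgroup containing `N` and `γ_n`). Layer-`n` form of gen 5's
`contOneCocycles_apply_mem_of_apply_mem`. [cite: SerreGaloisCohomology1997, I §2.2] -/
theorem contOneCocycles_layer_apply_mem_of_apply_mem {γ₀ : absoluteGaloisGroup K} (hγ₀ : κ.IsTopGenerator γ₀) (n : ℕ)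
    (A₁ : AddSubgroup M) (hstab : ∀ (σ : absoluteGaloisGroup K) (a : M), a ∈ A₁ → σ • a ∈ A₁)
    (ψ : contOneCocycles (discreteTopRep (κ.layerSubgroup n) M))
    (hN : ∀ τ : κ.layerSubgroup n, (τ : absoluteGaloisGroup K) ∈ κ.kerSubgroup → ψ.1 τ = 0)
    (hg : ψ.1 ⟨γ₀ ^ p ^ n, pow_mem_layerSubgroup κ hγ₀ n⟩ ∈ A₁) (σ : κ.layerSubgroup n) : ψ.1 σ ∈ A₁ := by
  -- adapted from Summits/.../Theorems/PublishedInputsGreenbergLemma34CocycleLemmas.lean (gen 5, layer 0)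
  let Hn := κ.layerSubgroup n
  let U : Subgroup Hn :=
    { carrier := {σ | ψ.1 σ ∈ A₁}
      one_mem' := by
        change ψ.1 1 ∈ A₁
        rw [contOneCocycles.apply_one]; exact A₁.zero_mem
      mul_mem' := fun {a b} ha hb ↦ by
        change ψ.1 (a * b) ∈ A₁
        have h := ψ.2 a b
        change ψ.1 (a * b) = ψ.1 a + (a : absoluteGaloisGroup K) • ψ.1 b at h
        rw [h]; exact A₁.add_mem ha (hstab _ _ hb)
      inv_mem' := fun {a} ha ↦ by
        change ψ.1 a⁻¹ ∈ A₁
        have h := ψ.2 a⁻¹ a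
        change ψ.1 (a⁻¹ * a) = ψ.1 a⁻¹ + ((a⁻¹ : Hn) : absoluteGaloisGroup K) • ψ.1 a at h
        rw [inv_mul_cancel, contOneCocycles.apply_one] at h
        have e : ψ.1 a⁻¹ = -(((a⁻¹ : Hn) : absoluteGaloisGroup K) • ψ.1 a) := eq_neg_of_add_eq_zero_left h.symm
        rw [e]; exact A₁.neg_mem (hstab _ _ ha) }
  have hUo : IsOpen (U : Set Hn) := by
    change IsOpen (ψ.1 ⁻¹' (A₁ : Set M))
    exact (isOpen_discrete _).preimage ψ.1.continuous
  have htop := layerSubgroup_subgroup_eq_top κ hγ₀ n U hUo (fun τ hτ ↦ by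
      change ψ.1 τ ∈ A₁
      rw [hN τ hτ]; exact A₁.zero_mem) hg
  exact (htop ▸ Subgroup.mem_top σ : σ ∈ U)

/-! ## §2 Inflation cocycles on `H_n` with a prescribed value at `γ_n` -/

omit [CharZero K] [TopologicalSpace M] [DiscreteTopology M] in
/-- Arithmetic of the layer: if `p^{n+m} ∣ κ g − a pⁿ` and `p^{n+m} ∣ κ g − a' pⁿ` then `a ≡ a' (mod p^m)`, so the norm sums
`s_a^{(γ)}(b)`, `s_{a'}^{(γ)}(b)` agree as soon as `s_{p^m}^{(γ)}(b) = 0`. [folklore] -/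
theorem sSeq_eq_of_dvd_sub_mul (γ : absoluteGaloisGroup K) (b : M) {n m : ℕ}
    (hnorm : sSeq γ b (p ^ m) = 0) (g : absoluteGaloisGroup K) {a a' : ℕ}
    (ha : (p : ℤ_[p]) ^ (n + m) ∣ (κ g).toAdd - (a : ℤ_[p]) * (p : ℤ_[p]) ^ n)
    (ha' : (p : ℤ_[p]) ^ (n + m) ∣ (κ g).toAdd - (a' : ℤ_[p]) * (p : ℤ_[p]) ^ n) :
    sSeq γ b a = sSeq γ b a' := by
  refine sSeq_eq_of_modEq γ b hnorm (Nat.modEq_iff_dvd.mpr ?_)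
  have hpn : ((p : ℤ_[p]) ^ n) ≠ 0 := pow_ne_zero n (by exact_mod_cast hp.out.ne_zero)
  have h1 : (p : ℤ_[p]) ^ m * (p : ℤ_[p]) ^ n ∣ ((a' : ℤ_[p]) - (a : ℤ_[p])) * (p : ℤ_[p]) ^ n := by
    have h := dvd_sub ha ha'
    rw [sub_sub_sub_cancel_left, ← sub_mul, pow_add, mul_comm ((p : ℤ_[p]) ^ n)] at h
    exact h
  have h2 : (p : ℤ_[p]) ^ m ∣ (((a' : ℤ) - (a : ℤ) : ℤ) : ℤ_[p]) := by
    have h := (mul_dvd_mul_iff_right hpn).mp h1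
    push_cast
    exact h
  rw [PadicInt.pow_p_dvd_int_iff] at h2
  exact_mod_cast h2

/-- **Inflation cocycles on `H_n` with an arbitrary prescribed value at `γ_n = γ₀^{pⁿ}`.** Let `κ` be a `ℤ_p`-extension of
`K` with topological generator `γ₀`, `M` a discrete `Γ_K`-module with continuous orbit maps, `b ∈ M` fixed by `N = ker κ`
with `s_{p^m}^{(γ_n)}(b) = 0`. Then there is a continuous cocycle `ψ` of `H_n = κ⁻¹(pⁿℤ_p)` vanishing on `N` with
`ψ(γ_n) = b`: `ψ(g) = s_a^{(γ_n)}(b)` for `κ g ≡ a pⁿ (mod p^{n+m})`, read off the decomposition `g = γ_n^a τ v`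
(`τ ∈ N`, `v ∈ κ⁻¹(p^{n+m}ℤ_p) ⊆ Stab(b)`); locally constant, hence continuous. Layer-`n` form of gen 5's
`ZpExtension.exists_cocycle_vanishing_apply_eq_of_sSeq_eq_zero`. [cite: SerreGaloisCohomology1997, I.§2.6, XIII.§1]
[cite: GreenbergLNM1716, §3 Lemmas 3.1–3.4 (pp. 86–89)] [cite: Washington1997, §13.1] -/
theorem exists_layerCocycle_vanishing_apply_eq_of_sSeq_eq_zero {γ₀ : absoluteGaloisGroup K}
    (hγ₀ : κ.IsTopGenerator γ₀) (n : ℕ)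
    (hcont : ∀ m : M, Continuous fun g : absoluteGaloisGroup K ↦ g • m) (b : M)
    (hb : ∀ τ ∈ κ.kerSubgroup, τ • b = b) {m : ℕ} (hnorm : sSeq (γ₀ ^ p ^ n) b (p ^ m) = 0) :
    ∃ ψ : contOneCocycles (discreteTopRep (κ.layerSubgroup n) M),
      (∀ τ : κ.layerSubgroup n, (τ : absoluteGaloisGroup K) ∈ κ.kerSubgroup → ψ.1 τ = 0) ∧
      ψ.1 ⟨γ₀ ^ p ^ n, pow_mem_layerSubgroup κ hγ₀ n⟩ = b := by
  -- adapted from Summits/.../Theorems/PublishedInputsGreenbergLemma34InflationCocycles.lean (gen 5, layer 0)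
  -- notation
  let G := absoluteGaloisGroup K
  let Hn : Subgroup G := κ.layerSubgroup n
  let γn : G := γ₀ ^ p ^ n
  let V : Subgroup G := κ.layerSubgroup (n + m)
  have hVo : IsOpen (V : Set G) := κ.isOpen_layerSubgroup (n + m)
  -- `γ_n^{p^m}` fixes `b`
  have hγb : γn ^ p ^ m • b = b := by
    have h := sSeq_add γn b (p ^ m) 1
    rw [hnorm, zero_add, sSeq_one, show p ^ m + 1 = 1 + 1 * p ^ m by ring,
      sSeq_add_mul_eq_of_sSeq_eq_zero γn b hnorm, sSeq_one] at h
    exact h.symm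
  -- the stabiliser of `b` is open and contains `ker κ` and `γ₀^{p^{n+m}} = γ_n^{p^m}`, hence `V`
  let U : Subgroup G := MulAction.stabilizer G b
  have hUo : IsOpen (U : Set G) := by
    have e : (U : Set G) = (fun g : G ↦ g • b) ⁻¹' {b} := by
      ext g
      exact MulAction.mem_stabilizer_iff
    rw [e]
    exact (isOpen_discrete _).preimage (hcont b)
  have hNU : κ.kerSubgroup ≤ U := fun τ hτ ↦ MulAction.mem_stabilizer_iff.mpr (hb τ hτ)
  have hVU : V ≤ U := κ.layerSubgroup_le_of_isOpen hγ₀ (n + m) U hUo hNU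
    (MulAction.mem_stabilizer_iff.mpr (by rw [pow_add, pow_mul]; exact hγb))
  have hVb : ∀ v ∈ V, v • b = b := fun v hv ↦ MulAction.mem_stabilizer_iff.mp (hVU hv)
  have hVs : ∀ v ∈ V, ∀ j, v • sSeq γn b j = sSeq γn b j := fun v hv j ↦ smul_sSeq γn b V hVb hv j
  have hNs : ∀ τ ∈ κ.kerSubgroup, ∀ j, τ • sSeq γn b j = sSeq γn b j := fun τ hτ j ↦
    smul_sSeq γn b κ.kerSubgroup hb hτ j
  -- the decomposition `g = γ_n^a τ v` of the elements of `H_n`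
  choose kx τx vx hτx hvx hx using fun g : Hn ↦ κ.exists_eq_pow_mul_mul hγ₀ n V hVo g.2
  -- `κ g ≡ (kx g) pⁿ (mod p^{n+m})`
  have hcong : ∀ g : Hn, (p : ℤ_[p]) ^ (n + m) ∣ (κ (g : G)).toAdd - (kx g : ℤ_[p]) * (p : ℤ_[p]) ^ n := by
    intro g
    have h1 : (κ ((γ₀ ^ p ^ n) ^ kx g * τx g)).toAdd = (kx g : ℤ_[p]) * (p : ℤ_[p]) ^ n :=
      κ.toAdd_map_pow_mul hγ₀ n (kx g) (hτx g)
    have h2 : (p : ℤ_[p]) ^ (n + m) ∣ (κ (vx g)).toAdd := ZpExtension.mem_layerSubgroup.mp (hvx g)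
    have e : κ (g : G) = κ ((γ₀ ^ p ^ n) ^ kx g * τx g * vx g) := congrArg κ (hx g)
    rw [e, map_mul, toAdd_mul, h1, add_sub_cancel_left]
    exact h2
  -- the function
  let ψf : Hn → M := fun g ↦ sSeq γn b (kx g)
  have hψf : ∀ (g : Hn) (a : ℕ), (p : ℤ_[p]) ^ (n + m) ∣ (κ (g : G)).toAdd - (a : ℤ_[p]) * (p : ℤ_[p]) ^ n →
      ψf g = sSeq γn b a :=
    fun g a ha ↦ sSeq_eq_of_dvd_sub_mul κ γn b hnorm (g : G) (hcong g) ha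
  -- continuity: `ψ` is constant on the cosets of the open subgroup `V`
  have hcontψ : Continuous ψf := by
    refine IsLocallyConstant.continuous ((IsLocallyConstant.iff_exists_open ψf).mpr fun x ↦ ?_)
    refine ⟨{y : Hn | (x : G)⁻¹ * (y : G) ∈ V}, ?_, ?_, fun y hy ↦ ?_⟩
    · exact hVo.preimage (continuous_const.mul continuous_subtype_val)
    · show (x : G)⁻¹ * (x : G) ∈ V
      rw [inv_mul_cancel]
      exact one_mem _
    · refine hψf y (kx x) ?_
      have hy' : (p : ℤ_[p]) ^ (n + m) ∣ (κ ((x : G)⁻¹ * (y : G))).toAdd := ZpExtension.mem_layerSubgroup.mp hy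
      have e : (κ (y : G)).toAdd = (κ (x : G)).toAdd + (κ ((x : G)⁻¹ * (y : G))).toAdd := by
        rw [← toAdd_mul, ← map_mul, mul_inv_cancel_left]
      rw [e, add_sub_right_comm]
      exact dvd_add (hcong x) hy'
  -- the cocycle identity
  have hmul : ∀ g h : Hn, ψf (g * h) = ψf g + (g : G) • ψf h := by
    intro g h
    have e1 : ψf (g * h) = sSeq γn b (kx g + kx h) := by
      refine hψf (g * h) (kx g + kx h) ?_
      have h' := dvd_add (hcong g) (hcong h)
      rw [Subgroup.coe_mul, map_mul, toAdd_mul, Nat.cast_add]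
      convert h' using 1
      ring
    have e2 : (g : G) • sSeq γn b (kx h) = ((γ₀ ^ p ^ n) ^ kx g * τx g * vx g) • sSeq γn b (kx h) := by
      rw [← hx g]
    rw [e1, sSeq_add]
    change _ = sSeq γn b (kx g) + (g : G) • sSeq γn b (kx h)
    rw [e2, mul_smul, mul_smul, hVs _ (hvx g), hNs _ (hτx g)]
  refine ⟨⟨⟨ψf, hcontψ⟩, fun g h ↦ hmul g h⟩, fun τ hτ ↦ ?_, ?_⟩
  · show ψf τ = 0
    rw [hψf τ 0 (by
      rw [ZpExtension.mem_kerSubgroup.mp hτ, toAdd_one, Nat.cast_zero, zero_mul, sub_zero]; exact dvd_zero _),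
      sSeq_zero]
  · show ψf ⟨γ₀ ^ p ^ n, _⟩ = b
    rw [hψf ⟨γ₀ ^ p ^ n, _⟩ 1 (by
      have h := κ.toAdd_map_pow_pow hγ₀ n 1
      rw [pow_one] at h
      change (p : ℤ_[p]) ^ (n + m) ∣ (κ (γ₀ ^ p ^ n)).toAdd - _
      rw [h, Nat.cast_one, sub_self]; exact dvd_zero _), sSeq_one]

/-- **Inflation cocycles on `H_n` for `p`-power-torsion classes of `M^N/(γ_n − 1)`.** With `κ`, `γ₀`, `n`, `M` as in
`exists_layerCocycle_vanishing_apply_eq_of_sSeq_eq_zero`: if `b, y ∈ M` are fixed by `N = ker κ` and `p^k b = γ_n y − y`,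
there is a continuous cocycle of `H_n` vanishing on `N` with value `b` at `γ_n` (some `γ_n^{p^A}` fixes `b` and `y` — the
stabilisers are open and contain `ker κ` — and then `s_{p^{A+k}}(b) = p^k s_{p^A}(b) = γ_n^{p^A} y − y = 0`). This is the
surjectivity half of `H¹(H_n/N, M^N) ≅ (M^N/(γ_n − 1))[p^∞]` (Greenberg: "`ker(r_{v_n}) ≅ H¹(Γ_{v_n}, ·)`", `Γ_{v_n}`
pro-cyclic on `γ_{v_n}`). [cite: GreenbergLNM1716, §3 Lemmas 3.1, 3.3, 3.4 (pp. 86–89)]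
[cite: SerreGaloisCohomology1997, XIII.§1] -/
theorem exists_layerCocycle_vanishing_apply_eq_of_nsmul_eq_sub {γ₀ : absoluteGaloisGroup K}
    (hγ₀ : κ.IsTopGenerator γ₀) (n : ℕ)
    (hcont : ∀ m : M, Continuous fun g : absoluteGaloisGroup K ↦ g • m) (b : M)
    (hb : ∀ τ ∈ κ.kerSubgroup, τ • b = b) {k : ℕ} {y : M} (hy : ∀ τ ∈ κ.kerSubgroup, τ • y = y)
    (hbk : p ^ k • b = (γ₀ ^ p ^ n) • y - y) :
    ∃ ψ : contOneCocycles (discreteTopRep (κ.layerSubgroup n) M),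
      (∀ τ : κ.layerSubgroup n, (τ : absoluteGaloisGroup K) ∈ κ.kerSubgroup → ψ.1 τ = 0) ∧
      ψ.1 ⟨γ₀ ^ p ^ n, pow_mem_layerSubgroup κ hγ₀ n⟩ = b := by
  let G := absoluteGaloisGroup K
  let γn : G := γ₀ ^ p ^ n
  -- an open subgroup fixing `b` and `y`, containing `ker κ`, hence some `γ₀^{p^A}` and so `γ_n^{p^A}`
  let U : Subgroup G := MulAction.stabilizer G b ⊓ MulAction.stabilizer G y
  have hUo : IsOpen (U : Set G) := by
    have e : (U : Set G) = (fun g : G ↦ g • b) ⁻¹' {b} ∩ (fun g : G ↦ g • y) ⁻¹' {y} := by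
      ext g
      rw [Subgroup.coe_inf, Set.mem_inter_iff, Set.mem_inter_iff]
      exact Iff.rfl
    rw [e]
    exact ((isOpen_discrete _).preimage (hcont b)).inter ((isOpen_discrete _).preimage (hcont y))
  have hNU : κ.kerSubgroup ≤ U := fun τ hτ ↦
    ⟨MulAction.mem_stabilizer_iff.mpr (hb τ hτ), MulAction.mem_stabilizer_iff.mpr (hy τ hτ)⟩
  obtain ⟨A, hA⟩ := κ.exists_pow_pow_mem_of_isOpen hγ₀ U hUo hNU
  have hAn : γn ^ p ^ A ∈ U := by
    have e : γn ^ p ^ A = (γ₀ ^ p ^ A) ^ p ^ n := by rw [← pow_mul, ← pow_mul, mul_comm]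
    rw [e]; exact U.pow_mem hA _
  have hnb : γn ^ p ^ A • b = b := MulAction.mem_stabilizer_iff.mp hAn.1
  have hny : γn ^ p ^ A • y = y := MulAction.mem_stabilizer_iff.mp hAn.2
  -- the norm condition at level `A + k`
  have hnorm : sSeq γn b (p ^ (A + k)) = 0 := by
    rw [pow_add, mul_comm, sSeq_mul_eq_nsmul γn b hnb, ← sSeq_nsmul, hbk, sSeq_smul_sub, hny, sub_self]
  exact exists_layerCocycle_vanishing_apply_eq_of_sSeq_eq_zero κ hγ₀ n hcont b hb hnorm

end Summit.BirchSwinnertonDyer.BirchSwinnertonDyer.Theorems.InputsGreenbergLemma34Layer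

end
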